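import Literature.NumberTheory.EllipticCurves.NewformsCoeffFieldProofs
import Literature.NumberTheory.EllipticCurves.EichlerShimuraPeriods
import HarnessLib

/-!
# The coefficient field of a newform on `Γ₀(N)` is a number field — unconditionally, all weights

Discharges of the named facts `IsNewform0.finiteDimensional_coeffField` and
`IsNewform0.isIntegral_coeff` of `Literature.NumberTheory.EllipticCurves.Newforms`
(Shimura 1971, Thm. 3.48; Diamond–Shurman Thm. 6.5.1, Def. 6.5.3):

* `gamma0_exists_heckeStableDualLattice_holds N k`: the Hecke-stable dual-lattice fact of
  `NewformsCoeffFieldProofs` holds in every weight — for `k < 2` vacuously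
  (`gamma0_exists_heckeStableDualLattice_of_lt_two`), and for `k = n + 2 ≥ 2` with the
  Eichler–Shimura period lattice `periodLatticeK n` of `EichlerShimuraPeriods`
  (`periodLatticeK_fg_heckeStable_separating`: finitely generated, `T_p^∨`-stable, separating;
  Shimura 1971, (3.5.20) and §8.4);
* `IsNewform0.finiteDimensional_coeffField_holds`, `IsNewform0.isIntegral_coeff_holds`: by
  `IsNewform0.finiteDimensional_coeffField_of_dualLattice`,
  `IsNewform0.isIntegral_coeff_of_dualLattice` of `NewformsCoeffFieldProofs` (the stabiliser of
  the finitely generated group of periods of a newform is a finitely generated ring containing all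
  `a_p(f)`, hence all `aₙ(f)`).

## References

* G. Shimura, *Introduction to the arithmetic theory of automorphic functions*, 1971, Thm. 3.48
  (p. 83), (3.5.20) (p. 84), Thm. 8.4, Prop. 8.5, Prop. 8.6, §8.4 (pp. 234–241).
* F. Diamond, J. Shurman, *A first course in modular forms*, GTM 228, 2005, Thm. 6.5.1, (6.12),
  Def. 6.5.3 (pp. 237–238).
-/

noncomputable section

open scoped MatrixGroups ModularForm

open CongruenceSubgroup UpperHalfPlane

namespace Literature.NumberTheory.EllipticCurves.ModularForms

variable (N : ℕ) [NeZero N] (k : ℤ)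

/-- **Shimura's Hecke-stable integral structure, dual form, in every weight** — discharge of
`gamma0_exists_heckeStableDualLattice`: for `k < 2` there are no cusp forms; for `k = n + 2` take
the Eichler–Shimura period lattice `periodLatticeK n ⊆ S_k(Γ₀(N))^∧`, which is finitely generated,
stable under all `T_p^∨` and separating (`periodLatticeK_fg_heckeStable_separating`)
(Shimura 1971, (3.5.20), p. 84, and its proof in §8.4, pp. 239–241). [cite: Shimura1971, (3.5.20) p. 84 and §8.4 pp. 239–241] -/
theorem gamma0_exists_heckeStableDualLattice_holds : gamma0_exists_heckeStableDualLattice N k := by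
  rcases lt_or_ge k 2 with hk | hk
  · exact gamma0_exists_heckeStableDualLattice_of_lt_two N k hk
  · obtain ⟨n, rfl⟩ : ∃ n : ℕ, k = (n : ℤ) + 2 := ⟨(k - 2).toNat, by omega⟩
    obtain ⟨h1, h2, h3⟩ := periodLatticeK_fg_heckeStable_separating N n
    exact ⟨periodLatticeK n, h1, h2, h3⟩

variable {N k}

/-- **The coefficient field `K_f = ℚ({aₙ(f)})` of a newform `f ∈ S_k(Γ₀(N))` is a number field**
— discharge of `IsNewform0.finiteDimensional_coeffField` (Shimura 1971, Thm. 3.48; Diamond–Shurman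
Def. 6.5.3 with Thm. 6.5.1 and (6.12)), from the dual lattice in weight `k`
(`gamma0_exists_heckeStableDualLattice_holds`) and
`IsNewform0.finiteDimensional_coeffField_of_dualLattice`. [cite: Shimura1971, Thm. 3.48, p. 83] -/
theorem IsNewform0.finiteDimensional_coeffField_holds :
    IsNewform0.finiteDimensional_coeffField (N := N) (k := k) :=
  IsNewform0.finiteDimensional_coeffField_of_dualLattice
    (gamma0_exists_heckeStableDualLattice_holds N k)

/-- **The Fourier coefficients of a newform `f ∈ S_k(Γ₀(N))` are algebraic integers** — discharge
of `IsNewform0.isIntegral_coeff` (Shimura 1971, Thm. 3.48(3); Diamond–Shurman Thm. 6.5.1), from the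
dual lattice in weight `k` and `IsNewform0.isIntegral_coeff_of_dualLattice`. [cite: Shimura1971, Thm. 3.48(3), p. 83] -/
theorem IsNewform0.isIntegral_coeff_holds : IsNewform0.isIntegral_coeff (N := N) (k := k) :=
  IsNewform0.isIntegral_coeff_of_dualLattice (gamma0_exists_heckeStableDualLattice_holds N k)

end Literature.NumberTheory.EllipticCurves.ModularForms
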